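import Summits.MatrixMultiplication.MatrixMultiplication.Theses.EPRFaces

/-!
# MatrixMultiplication / EPRFaces — `Assembly` (stmt-MatrixMultiplication-7251)

Route `EPRFaces`, assembly item `Assembly`:
`FaceMaximiser → PerfectAmortisation → MatrixMultiplication`.

Proof (six lines of real arithmetic, the same as the route's deciding theorem `closes`):
given `ε > 0`, perfect amortisation `E` yields `k ≥ 1` with `R(⟨n,n,n^k⟩) = O(n^{k+1+ε/2})`;
the face-maximiser statement `B` applied to that admissible exponent gives
`ω + (k − 1) ≤ k + 1 + ε/2`, so `ω < 2 + ε` for every `ε > 0`, i.e. `ω ≤ 2`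
(`le_of_forall_pos_lt_add`); and `2 ≤ ω` is the flattening bound
(`Literature.Computability.AlgebraicComplexity.omega_two_le`). Hence `ω(ℂ) = 2`, which is
`MatrixMultiplication` (`MatrixMultiplication_iff`).
-/

-- the tree's namespace `Summit.MatrixMultiplication.MatrixMultiplication.…` repeats a component by design
set_option linter.dupNamespace false

namespace Summit.MatrixMultiplication.MatrixMultiplication.Theorems

open Summit.MatrixMultiplication.MatrixMultiplication.Theses.EPRFaces

/-- **Assembly** (route EPRFaces, stmt-MatrixMultiplication-7251): the face-maximiser statement
`B` (`ω + (k − 1) ≤ β` for every admissible `β` of shape `(1,1,k)`, `k ≥ 1`) and perfect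
amortisation `E` (`∀ ε > 0 ∃ k ≥ 1, R(⟨n,n,n^k⟩) = O(n^{k+1+ε})`) together give `ω(ℂ) = 2`:
`E` at `ε/2` produces an admissible exponent `k + 1 + ε/2`, `B` turns it into `ω ≤ 2 + ε/2 < 2 + ε`,
so `ω ≤ 2`, and `2 ≤ ω` is the flattening bound. -/
theorem eprFaces_assembly_proof :
    Summit.MatrixMultiplication.MatrixMultiplication.Theses.EPRFaces.Assembly := by
  unfold Assembly
  intro hB hE
  have hle : Literature.Computability.AlgebraicComplexity.omega ℂ ≤ 2 := by
    refine le_of_forall_pos_lt_add fun ε hε => ?_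
    obtain ⟨k, hk, hO⟩ := hE (ε / 2) (half_pos hε)
    have h := hB k hk ((k : ℝ) + 1 + ε / 2) hO
    linarith
  exact (_root_.MatrixMultiplication_iff).2
    (le_antisymm hle (Literature.Computability.AlgebraicComplexity.omega_two_le ℂ))

end Summit.MatrixMultiplication.MatrixMultiplication.Theorems
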